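import Literature.Geometry.Symplectic.PALFFibreCollarLevels
import Literature.Topology.FourManifolds.SubmersionStraightening
import Literature.Topology.FourManifolds.ComplementConnected
import HarnessLib

/-!
# Boundary points of a fibre: small neighbourhoods with connected fibre complement

Topic `Literature/Geometry/Symplectic` (local lemma for the connectedness of the regular fibre of a
Lefschetz fibration over the disc, fact seat `provefact-Literature.Geometry.Symplectic.Oba2016_s-add47373d4`).
For a PALF `f : W → 𝔻²` (`Literature.Geometry.Symplectic.PALF`) and a boundary point `z` of the fibre over a point `u`
of the open disc (a point of the horizontal boundary, where `f ∘ incl` is a submersion), `z` has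
arbitrarily small neighbourhoods `N` with `N \ f⁻¹(u)` nonempty and preconnected.  In the
fibre-preserving collar of `PALF.exists_flowoutInput_mfderiv_eq_zero` the fibre is the product of
its boundary trace with the collar interval, so `N \ f⁻¹(u)` is the image of
`(N₀ \ (f ∘ incl)⁻¹(u)) × [0, t₀)` for a small neighbourhood `N₀` of `z` in `∂W` with preconnected
level complement (a straightening chart of the submersion `f ∘ incl` on the boundary manifold).

* `exists_nhds_subset_isPreconnected_diff_fibre_of_model` — the local lemma of
  `FibreComplementLocal.lean` for an arbitrary model on `ℝᴺ` and a map to `ℝ²`;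
* `PALF.exists_nhds_subset_isPreconnected_diff_fibre_of_mem_boundary` — the boundary case.

Everything is proved; no definitions, no named facts.

## References

* A. Kas, *On the handlebody decomposition associated to a Lefschetz fibration*, Pacific J.
  Math. 89 (1980), §2. [Kas1980]
* M. W. Hirsch, *Differential Topology*, GTM 33 (1976), Ch. 1 §3, Thm. 3.2. [HirschDT1976]
-/

open scoped Manifold ContDiff Topology
open Set Function Filter Metric Module

noncomputable section

namespace Literature.Geometry.Symplectic

open Literature.Topology.FourManifolds

universe u

/-! ### §1 The local lemma for a general model -/

/-- **Small neighbourhoods of an interior regular point with connected fibre complement**, for a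
smooth map `f : M → ℝ²` on a manifold modelled on a model with corners on `ℝᴺ`, `a + 2 = N`:
inside every neighbourhood of an interior point `z` with `df_z` onto there is a neighbourhood `N`
with `N \ f⁻¹(f z)` preconnected (straightening chart; a ball minus a codimension-`2` subspace).
[cite: HirschDT1976, Ch. 1 §3, Thm. 3.2] -/
theorem exists_nhds_subset_isPreconnected_diff_fibre_of_model {a N : ℕ} (hab : a + 2 = N)
    {H : Type*} [TopologicalSpace H] {I : ModelWithCorners ℝ (EuclideanSpace ℝ (Fin N)) H}
    {M : Type*} [TopologicalSpace M] [ChartedSpace H M] [IsManifold I ∞ M]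
    {f : M → EuclideanSpace ℝ (Fin 2)} (hf : ContMDiff I 𝓘(ℝ, EuclideanSpace ℝ (Fin 2)) ∞ f) {z : M}
    (hz : I.IsInteriorPoint z)
    (hsurj : Surjective (mfderiv I 𝓘(ℝ, EuclideanSpace ℝ (Fin 2)) f z))
    (c : EuclideanSpace ℝ (Fin a)) (hc : appendCLE hab (c, 0) ∈ interior (range I))
    {U : Set M} (hU : U ∈ 𝓝 z) :
    ∃ N' ∈ 𝓝 z, N' ⊆ U ∧ IsPreconnected (N' \ f ⁻¹' {f z}) := by
  obtain ⟨ψ, -, hzψ, hψz, hψf, hψint⟩ := exists_straighteningChart hab hf hz hsurj c hc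
  set χ := ψ.extend I with hχ
  set q₀ : EuclideanSpace ℝ (Fin N) := I (ψ z) with hq₀
  have hχz : χ z = q₀ := rfl
  have hzsrc : z ∈ χ.source := by rw [hχ, ψ.extend_source]; exact hzψ
  set T : Set (EuclideanSpace ℝ (Fin N)) := I.symm ⁻¹' ψ.target ∩ interior (range I) with hT
  have hTopen : IsOpen T := (ψ.open_target.preimage I.continuous_symm).inter isOpen_interior
  have hq₀T : q₀ ∈ T := by
    refine ⟨?_, hψint z hzψ⟩
    show I.symm (I (ψ z)) ∈ ψ.target
    rw [I.left_inv]; exact ψ.map_source hzψ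
  have hTsub : T ⊆ χ.target := by
    rintro q ⟨hq, hq'⟩
    rw [hχ, ψ.extend_target]
    exact ⟨hq, interior_subset hq'⟩
  have hsymm_cont : ContinuousOn χ.symm χ.target := ψ.continuousOn_extend_symm
  have hsymm_q₀ : χ.symm q₀ = z := by rw [← hχz]; exact ψ.extend_left_inv (I := I) hzψ
  have h1 : ∀ᶠ q in 𝓝 q₀, q ∈ T := hTopen.mem_nhds hq₀T
  have h2 : ∀ᶠ q in 𝓝[χ.target] q₀, χ.symm q ∈ U := by
    have hcw : ContinuousWithinAt χ.symm χ.target q₀ := hsymm_cont q₀ (hTsub hq₀T)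
    rw [ContinuousWithinAt, hsymm_q₀] at hcw
    exact hcw hU
  obtain ⟨ε, hε, hballT, hballU⟩ : ∃ ε > 0, ball q₀ ε ⊆ T ∧ ∀ q ∈ ball q₀ ε, χ.symm q ∈ U := by
    obtain ⟨ε₁, hε₁, h1'⟩ := Metric.eventually_nhds_iff_ball.1 h1
    obtain ⟨ε₂, hε₂, h2'⟩ := Metric.mem_nhdsWithin_iff.1 h2
    refine ⟨min ε₁ ε₂, lt_min hε₁ hε₂, fun q hq => h1' q (ball_subset_ball (min_le_left _ _) hq),
      fun q hq => h2' ⟨ball_subset_ball (min_le_right _ _) hq, hTsub (h1' q ?_)⟩⟩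
    exact ball_subset_ball (min_le_left _ _) hq
  set N' : Set M := χ.symm '' ball q₀ ε with hN'
  have hNeq : N' = χ.source ∩ χ ⁻¹' ball q₀ ε :=
    χ.symm_image_eq_source_inter_preimage (hballT.trans hTsub)
  have hNnhds : N' ∈ 𝓝 z := by
    rw [hNeq]
    exact (ψ.isOpen_extend_preimage' isOpen_ball).mem_nhds
      ⟨hzsrc, by rw [mem_preimage, hχz]; exact mem_ball_self hε⟩
  have hNU : N' ⊆ U := by
    rintro x ⟨q, hq, rfl⟩
    exact hballU q hq
  refine ⟨N', hNnhds, hNU, ?_⟩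
  set K : Submodule ℝ (EuclideanSpace ℝ (Fin N)) := LinearMap.ker
    ((LinearMap.snd ℝ (EuclideanSpace ℝ (Fin a)) (EuclideanSpace ℝ (Fin 2))).comp
      ((appendCLE hab).symm : EuclideanSpace ℝ (Fin N) ≃L[ℝ]
        (EuclideanSpace ℝ (Fin a) × EuclideanSpace ℝ (Fin 2))).toLinearEquiv.toLinearMap) with hK
  have hmemK : ∀ q : EuclideanSpace ℝ (Fin N), q ∈ K ↔ ((appendCLE hab).symm q).2 = 0 := fun q =>
    Iff.rfl
  have hcodim : 1 < Module.rank ℝ (EuclideanSpace ℝ (Fin N) ⧸ K) := by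
    set Λ := (LinearMap.snd ℝ (EuclideanSpace ℝ (Fin a)) (EuclideanSpace ℝ (Fin 2))).comp
      ((appendCLE hab).symm : EuclideanSpace ℝ (Fin N) ≃L[ℝ]
        (EuclideanSpace ℝ (Fin a) × EuclideanSpace ℝ (Fin 2))).toLinearEquiv.toLinearMap with hΛ
    have hsurjΛ : Surjective Λ := by
      intro w
      refine ⟨appendCLE hab (0, w), ?_⟩
      show ((appendCLE hab).symm (appendCLE hab (0, w))).2 = w
      rw [ContinuousLinearEquiv.symm_apply_apply]
    have e := Λ.quotKerEquivOfSurjective hsurjΛ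
    rw [e.rank_eq, ← Module.finrank_eq_rank, finrank_euclideanSpace_fin]
    norm_num
  have hq₀K : q₀ ∈ K := by
    rw [hmemK]
    show ((appendCLE hab).symm q₀).2 = 0
    rw [hψz, ContinuousLinearEquiv.symm_apply_apply]
  have hfibre : ∀ q ∈ ball q₀ ε, (χ.symm q ∈ f ⁻¹' {f z} ↔ q - q₀ ∈ K) := by
    intro q hq
    have hqt : q ∈ χ.target := hTsub (hballT hq)
    have hsrc : χ.symm q ∈ ψ.source := by
      rw [← ψ.extend_source (I := I)]; exact χ.map_target hqt
    have hχq : I (ψ (χ.symm q)) = q := χ.right_inv hqt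
    have h := hψf (χ.symm q) hsrc
    rw [hχq] at h
    rw [K.sub_mem_iff_left hq₀K, hmemK, h, mem_preimage, mem_singleton_iff, sub_eq_zero]
  have himage : N' \ f ⁻¹' {f z} = χ.symm '' (ball q₀ ε \ {q | q - q₀ ∈ K}) := by
    ext x
    constructor
    · rintro ⟨⟨q, hq, rfl⟩, hx⟩
      exact ⟨q, ⟨hq, fun h => hx ((hfibre q hq).2 h)⟩, rfl⟩
    · rintro ⟨q, ⟨hq, hqK⟩, rfl⟩
      exact ⟨⟨q, hq, rfl⟩, fun h => hqK ((hfibre q hq).1 h)⟩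
  rw [himage]
  exact (isPreconnected_ball_diff_vadd_submodule hcodim q₀ hε).image χ.symm
    (hsymm_cont.mono (Set.sdiff_subset.trans (hballT.trans hTsub)))

/-! ### §2 Boundary points of a fibre of a PALF -/

variable {W : Type u} [TopologicalSpace W] [ChartedSpace (EuclideanHalfSpace 4) W]
  [IsManifold (𝓡∂ 4) ∞ W] [T2Space W] [CompactSpace W]
  {o : SmoothOrientation (𝓡∂ 4) W} {b : BoundaryData (𝓡∂ 4) W (𝓡 3)}

namespace PALF

/-- A submersive smooth map is not constant near a point: `f⁻¹(f y)` is not a neighbourhood of a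
point `y` where `df_y` is onto. [folklore] -/
theorem not_mem_nhds_preimage_of_surjective {M : Type*} [TopologicalSpace M]
    [ChartedSpace (EuclideanSpace ℝ (Fin 3)) M] [IsManifold (𝓡 3) ∞ M]
    {g : M → EuclideanSpace ℝ (Fin 2)} {y : M}
    (hsurj : Surjective (mfderiv (𝓡 3) 𝓘(ℝ, EuclideanSpace ℝ (Fin 2)) g y)) :
    g ⁻¹' {g y} ∉ 𝓝 y := by
  intro h
  have hev : g =ᶠ[𝓝 y] fun _ => g y := by
    filter_upwards [h] with x hx using hx
  have h0 : mfderiv (𝓡 3) 𝓘(ℝ, EuclideanSpace ℝ (Fin 2)) g y = 0 := by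
    rw [hev.mfderiv_eq]; exact mfderiv_const
  obtain ⟨v, hv⟩ := hsurj (EuclideanSpace.single 0 1)
  rw [h0] at hv
  have : (EuclideanSpace.single (0 : Fin 2) (1 : ℝ)) 0 = 0 := by rw [← hv]; rfl
  simp at this

/-- **Boundary points of a fibre have small neighbourhoods with connected fibre complement**
(Kas 1980, §2: near `∂W` the fibration is the product of its boundary trace with the collar).
For a PALF, a point `u` of the open disc and a boundary point `z` of the fibre `f⁻¹(u)`, inside
every neighbourhood of `z` there is a neighbourhood `N` with `N \ f⁻¹(u)` nonempty and
preconnected. [cite: Kas1980, §2] -/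
theorem exists_nhds_subset_isPreconnected_diff_fibre_of_mem_boundary (P : PALF o b)
    {z : W} (hzb : z ∈ (𝓡∂ 4).boundary W) (hu : ‖P.f z‖ < 1) {U : Set W} (hU : U ∈ 𝓝 z) :
    ∃ N' ∈ 𝓝 z, N' ⊆ U ∧ (N' \ P.f ⁻¹' {P.f z}).Nonempty ∧ IsPreconnected (N' \ P.f ⁻¹' {P.f z}) := by
  haveI : Nonempty b.carrier := P.nonempty_carrier
  -- the boundary point and the boundary submersion
  have hzb' := hzb
  rw [← b.range_incl] at hzb'
  obtain ⟨y₀, hy₀⟩ := hzb'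
  set g : b.carrier → EuclideanSpace ℝ (Fin 2) := P.f ∘ b.incl with hg
  have hgs : ContMDiff (𝓡 3) 𝓘(ℝ, EuclideanSpace ℝ (Fin 2)) ∞ g := P.contMDiff.comp b.isSmoothEmbedding.contMDiff
  have hgy₀ : g y₀ = P.f z := by show P.f (b.incl y₀) = P.f z; rw [hy₀]
  have hsurj : Surjective (mfderiv (𝓡 3) 𝓘(ℝ, EuclideanSpace ℝ (Fin 2)) g y₀) :=
    P.boundary_submersion y₀ (by rw [show P.f (b.incl y₀) = g y₀ from rfl, hgy₀]; exact hu)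
  -- the fibre-preserving collar
  set r : ℝ := (‖P.f z‖ + 1) / 2 with hr
  have hr0 : 0 < r := by rw [hr]; linarith [norm_nonneg (P.f z)]
  have hr1 : r < 1 := by rw [hr]; linarith
  have hzr : ‖P.f z‖ < r := by rw [hr]; linarith
  obtain ⟨D⟩ := (nonempty_flowoutInput : Nonempty (FlowoutInput 3 W))
  obtain ⟨D', s, hs, hfeq, hpres0⟩ := P.exists_flowoutInput_mfderiv_eq_zero D hr0 hr1
  have hpres : ∀ x, ‖P.f x‖ ≤ r → D'.f x ≤ s →
      mfderiv (𝓡∂ 4) 𝓘(ℝ, EuclideanSpace ℝ (Fin 2)) P.f x (D'.ξ x) = 0 :=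
    fun x h1 h2 => hpres0 x h1 (by rw [← hfeq]; exact h2)
  obtain ⟨Γ⟩ := D'.nonempty_cover
  set O := Γ.openCollarData b with hO
  -- `f` is preserved along the collar lines from boundary points with `‖f‖ < r`, for times `≤ s`
  have hfO : ∀ (y : b.carrier) (t : ℝ), ‖g y‖ < r → t ∈ Ico (0 : ℝ) 2 → t * (Γ.a / 2) ≤ s →
      P.f (O.toFun y t) = g y := by
    intro y t hy ht hts
    have hσ0 : D'.f (b.incl y) = 0 := D'.f_incl b y
    have hza : D'.f (b.incl y) ≤ Γ.a := by rw [hσ0]; exact Γ.a_pos.le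
    have htI : t * (Γ.a / 2) ∈ Icc (-D'.f (b.incl y)) Γ.a := by
      rw [hσ0, neg_zero]
      refine ⟨by nlinarith [ht.1, Γ.a_pos], ?_⟩
      nlinarith [ht.2, Γ.a_pos]
    show P.f (Γ.Fl (b.incl y) (t * (Γ.a / 2))) = P.f (b.incl y)
    exact P.apply_Fl_eq Γ hpres hza hy (by rw [hσ0]; exact hs.le) htI (by rw [hσ0, zero_add]; exact hts)
  -- continuity of the collar map at `(y₀, 0)` : a product neighbourhood mapped into `U ∩ {‖f‖ < r}`
  have hcont : ContinuousOn (uncurry O.toFun) (univ ×ˢ Ico 0 O.top) := O.continuousOn_toFun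
  have htop : O.top = 2 := rfl
  have h0mem : ((y₀, (0 : ℝ)) : b.carrier × ℝ) ∈ univ ×ˢ Ico (0 : ℝ) O.top :=
    ⟨mem_univ _, ⟨le_rfl, O.top_pos⟩⟩
  have hval : uncurry O.toFun (y₀, 0) = z := by
    show O.toFun y₀ 0 = z; rw [O.apply_zero, hy₀]
  have hpre : (uncurry O.toFun) ⁻¹' U ∈ 𝓝[univ ×ˢ Ico (0 : ℝ) O.top] (y₀, (0 : ℝ)) := by
    have hcw := hcont (y₀, 0) h0mem
    rw [ContinuousWithinAt, hval] at hcw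
    exact hcw hU
  rw [nhdsWithin_prod_eq, nhdsWithin_univ] at hpre
  obtain ⟨A, hA, B, hB, hAB⟩ := Filter.mem_prod_iff.1 hpre
  obtain ⟨δ, hδ, hδB⟩ := Metric.mem_nhdsWithin_iff.1 hB
  -- the time bound
  set t₀ : ℝ := min (min δ 1) (s / Γ.a) with ht₀
  have ht₀pos : 0 < t₀ := lt_min (lt_min hδ one_pos) (div_pos hs Γ.a_pos)
  have ht₀δ : t₀ ≤ δ := (min_le_left _ _).trans (min_le_left _ _)
  have ht₀1 : t₀ ≤ 1 := (min_le_left _ _).trans (min_le_right _ _)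
  have ht₀s : ∀ t, t < t₀ → 0 ≤ t → t * (Γ.a / 2) ≤ s := by
    intro t ht ht0
    have h1 : t ≤ s / Γ.a := ht.le.trans (min_le_right _ _)
    have h2 : t * Γ.a ≤ s := by rwa [le_div_iff₀ Γ.a_pos] at h1
    nlinarith [Γ.a_pos]
  have hIco : ∀ t, t ∈ Ico (0 : ℝ) t₀ → t ∈ Ico (0 : ℝ) 2 := fun t ht =>
    ⟨ht.1, by linarith [ht.2, ht₀1]⟩
  have hBt : ∀ t, t ∈ Ico (0 : ℝ) t₀ → t ∈ B := fun t ht =>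
    hδB ⟨by rw [mem_ball, Real.dist_eq, sub_zero, abs_of_nonneg ht.1]; linarith [ht.2, ht₀δ],
      ⟨ht.1, by rw [htop]; linarith [ht.2, ht₀1]⟩⟩
  -- the boundary neighbourhood
  have hAr : A ∩ {y | ‖g y‖ < r} ∈ 𝓝 y₀ :=
    inter_mem hA ((isOpen_lt (continuous_norm.comp hgs.continuous) continuous_const).mem_nhds
      (by show ‖g y₀‖ < r; rw [hgy₀]; exact hzr))
  obtain ⟨N₀, hN₀, hN₀sub, hN₀c⟩ := exists_nhds_subset_isPreconnected_diff_fibre_of_model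
    (show 1 + 2 = 3 from rfl) hgs (z := y₀) BoundarylessManifold.isInteriorPoint hsurj 0
    (appendCLE_zero_mem_interior_range_euclidean (show 1 + 2 = 3 from rfl) 0) hAr
  have hN₀A : ∀ y ∈ N₀, y ∈ A := fun y hy => (hN₀sub hy).1
  have hN₀r : ∀ y ∈ N₀, ‖g y‖ < r := fun y hy => (hN₀sub hy).2
  -- the neighbourhood
  set N' : Set W := (uncurry O.toFun) '' (N₀ ×ˢ Ico (0 : ℝ) t₀) with hN'
  have hfN : ∀ y ∈ N₀, ∀ t ∈ Ico (0 : ℝ) t₀, P.f (O.toFun y t) = g y := fun y hy t ht =>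
    hfO y t (hN₀r y hy) (hIco t ht) (ht₀s t ht.2 ht.1)
  -- `N'` is a neighbourhood of `z`
  have hzregion : z ∈ O.region := by
    rw [← hval]; exact O.mem_region y₀ 0 ⟨le_rfl, O.top_pos⟩
  have hNnhds : N' ∈ 𝓝 z := by
    set G : Set W := O.region ∩ O.proj ⁻¹' interior N₀ ∩ O.height ⁻¹' Iio t₀ with hG
    have hGo : IsOpen G := by
      have h1 : IsOpen (O.region ∩ O.proj ⁻¹' interior N₀) :=
        O.continuousOn_proj.isOpen_inter_preimage O.isOpen_region isOpen_interior
      have h2 : IsOpen (O.region ∩ O.height ⁻¹' Iio t₀) :=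
        O.continuousOn_height.isOpen_inter_preimage O.isOpen_region isOpen_Iio
      have : G = (O.region ∩ O.proj ⁻¹' interior N₀) ∩ (O.region ∩ O.height ⁻¹' Iio t₀) := by
        ext x; simp only [hG, mem_inter_iff, mem_preimage]; tauto
      rw [this]; exact h1.inter h2
    have hzG : z ∈ G := by
      refine ⟨⟨hzregion, ?_⟩, ?_⟩
      · show O.proj z ∈ interior N₀
        rw [← hval]
        show O.proj (O.toFun y₀ 0) ∈ interior N₀
        rw [O.proj_apply y₀ 0 ⟨le_rfl, O.top_pos⟩]
        exact mem_interior_iff_mem_nhds.2 hN₀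
      · show O.height z < t₀
        rw [← hval]
        show O.height (O.toFun y₀ 0) < t₀
        rw [O.height_apply y₀ 0 ⟨le_rfl, O.top_pos⟩]
        exact ht₀pos
    have hGN : G ⊆ N' := by
      rintro x ⟨⟨hxr, hxp⟩, hxh⟩
      refine ⟨(O.proj x, O.height x), ⟨interior_subset hxp, (O.height_mem x hxr).1, hxh⟩, ?_⟩
      exact O.apply_proj_height x hxr
    exact mem_of_superset (hGo.mem_nhds hzG) hGN
  -- `N' ⊆ U`
  have hNU : N' ⊆ U := by
    rintro x ⟨⟨y, t⟩, ⟨hy, ht⟩, rfl⟩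
    exact hAB (show (y, t) ∈ A ×ˢ B from ⟨hN₀A y hy, hBt t ht⟩)
  -- the fibre complement in `N'`
  have himage : N' \ P.f ⁻¹' {P.f z} =
      (uncurry O.toFun) '' ((N₀ \ g ⁻¹' {g y₀}) ×ˢ Ico (0 : ℝ) t₀) := by
    ext x
    constructor
    · rintro ⟨⟨⟨y, t⟩, ⟨hy, ht⟩, rfl⟩, hx⟩
      refine ⟨(y, t), ⟨⟨hy, fun h => hx ?_⟩, ht⟩, rfl⟩
      show P.f (O.toFun y t) ∈ ({P.f z} : Set _)
      rw [mem_singleton_iff, hfN y hy t ht, ← hgy₀]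
      exact h
    · rintro ⟨⟨y, t⟩, ⟨⟨hy, hyg⟩, ht⟩, rfl⟩
      refine ⟨⟨(y, t), ⟨hy, ht⟩, rfl⟩, fun h => hyg ?_⟩
      have h' : P.f (O.toFun y t) = P.f z := h
      show g y = g y₀
      rw [← hfN y hy t ht, h', hgy₀]
  refine ⟨N', hNnhds, hNU, ?_, ?_⟩
  · -- nonempty
    rw [himage]
    have hne : (N₀ \ g ⁻¹' {g y₀}).Nonempty := by
      by_contra h
      rw [not_nonempty_iff_eq_empty, Set.sdiff_eq_empty] at h
      exact not_mem_nhds_preimage_of_surjective hsurj (mem_of_superset hN₀ h)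
    obtain ⟨y, hy⟩ := hne
    exact ⟨_, ⟨(y, 0), ⟨hy, le_rfl, ht₀pos⟩, rfl⟩⟩
  · -- preconnected
    rw [himage]
    refine (hN₀c.prod isPreconnected_Ico).image _ (hcont.mono ?_)
    rintro ⟨y, t⟩ ⟨-, ht⟩
    exact ⟨mem_univ _, by rw [htop]; exact hIco t ht⟩

end PALF

end Literature.Geometry.Symplectic

end
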